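import Summits.NavierStokesRegularity.NavierStokesRegularity.Theorems.SoloSalvageWu2026ConstructTools
import HarnessLib

/-!
# C177 `Wu2026` — sub-binder (D) of `Step_construct`: the inherited scale-invariant weak bounds
# (3.61) of the Euler blow-down tangent (cell `pub/ns-inputs`, seat `ns-in-wu-con`; route business
# of `GaldiLiouvilleGate`, item stmt-NavierStokesRegularity-0897)

Piece (D) of the assembly `step_construct_of_pieces` (`SoloSalvageWu2026Construct.lean`): for ANY
limit pair `(V, P)` of the blow-down sequence `V_j = R_j^{2/3} v(R_j ·) → V` in `L⁴_loc(ℝ³ ∖ {0})`,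
`P_j = R_j^{4/3}(p − c)(R_j ·) → P` in `L²_loc(ℝ³ ∖ {0})`, the weak bounds of the flow
(`v ∈ L^{9/2,∞}`, `𝒬 = (p − c) + |v|²/2 ∈ L^{9/4,∞}`, (3.17)/(3.41)) are inherited on every annulus
`A_R`: `|{y ∈ A_R : |V| > t}| ≤ C t^{-9/2}`, `|{|Q| > t}| ≤ C t^{-9/4}`, `|{|Q||V| > t}| ≤ C t^{-3/2}`,
`Q = P + |V|²/2`, with `C = ‖v‖^{9/2}_{9/2,∞} + ‖𝒬‖^{9/4}_{9/4,∞}` (p.21 l.5–24 «(3.61)», via Lemma 3.2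
p.11 «stability of local weak-Lorentz bounds»). Route: the distribution functions of `V_j`,
`Q_j = R_j^{4/3}𝒬(R_j ·)` are those of `v`, `𝒬` up to the exact scaling (`…ConstructTools`), so the
Chebyshev bounds are uniform in `j`, and levelwise bounds pass to the `L⁴(K)` / `L¹(K)` limits on
the closed shell `K ⊇ A_R` (`meas_lt_norm_le_of_tendsto_eLpNorm`).

Theorems only, standard axioms, no `sorry`.

WHAT THIS IS NOT: not a proof of `Step_construct` (pieces (A), (B), (C), (E) remain); not a claim
about NS regularity or blow-up; not a claim about any author beyond the typed locator.
-/

set_option linter.dupNamespace false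

noncomputable section

open MeasureTheory Set Filter Topology Module Metric
open scoped ENNReal NNReal Topology RealInnerProductSpace Pointwise

namespace Summit.NavierStokesRegularity.NavierStokesRegularity.Theorems.Wu2026Salvage

open Literature.Analysis.FluidPDE Literature.Analysis.FunctionSpaces Literature.Claims.NS.Wu2026


/-! ## Piece (D): the inherited weak bounds (3.61) -/

/-- **Sub-binder (D) of `Step_construct` — the inherited scale-invariant weak bounds (3.61)**
(p.21 l.5–24 «the Euler tangent inherits the scale-invariant weak bounds
‖V‖_{L^{9/2,∞}(A_R)} + ‖Q‖_{L^{9/4,∞}(A_R)} + ‖QV‖_{L^{3/2,∞}(A_R)} ≤ C uniformly in R > 0»; Lemma 3.2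
p.11): for any `L⁴_loc × L²_loc` limit `(V, P)` of the blow-down sequence along scales `2^{n_j}`,
with `C = ‖v‖^{9/2}_{9/2,∞} + ‖𝒬‖^{9/4}_{9/4,∞}`. This is hypothesis `hD` of
`step_construct_of_pieces` verbatim. [cite: Wu2026, (3.61) p.21 l.5–24; Lemma 3.2 p.11] -/
theorem step_construct_pieceD :
    ∀ ν : ℝ, 0 < ν → ∀ (v : E3 → E3) (p : E3 → ℝ), IsWuFlow ν v p →
      MemWeakLp v ((9 : ℝ≥0∞) / 2) volume →
      ∀ c : ℝ, MemWeakLp (fun x => p x - c) ((9 : ℝ≥0∞) / 4) volume →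
        MemWeakLp (bern v (fun x => p x - c)) ((9 : ℝ≥0∞) / 4) volume →
      ∀ n : ℕ → ℕ, Tendsto n atTop atTop →
      ∀ (V : E3 → E3) (P : E3 → ℝ), AEStronglyMeasurable V volume →
        AEStronglyMeasurable P volume →
        (∀ K : Set E3, IsCompact K → K ⊆ punctured →
          IntegrableOn (fun y => ‖V y‖ ^ (4 : ℝ)) K ∧
            IntegrableOn (fun y => |P y| ^ ((4 : ℝ) / 2)) K) →
        (∀ K : Set E3, IsCompact K → K ⊆ punctured →
          Tendsto (fun j => ∫ y in K, ‖blowDown ((2 : ℝ) ^ n j) v y - V y‖ ^ (4 : ℝ))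
            atTop (𝓝 0)) →
        (∀ K : Set E3, IsCompact K → K ⊆ punctured →
          Tendsto (fun j => ∫ y in K,
            |blowDownP ((2 : ℝ) ^ n j) (fun x => p x - c) y - P y| ^ ((4 : ℝ) / 2))
            atTop (𝓝 0)) →
      ∃ C : ℝ, 0 ≤ C ∧ ∀ R : ℝ, 0 < R → ∀ t : ℝ, 0 < t →
        (volume {y | y ∈ annulus R ∧ t < ‖V y‖}).toReal ≤ C * t ^ (-((9 : ℝ) / 2)) ∧
        (volume {y | y ∈ annulus R ∧ t < |bern V P y|}).toReal ≤ C * t ^ (-((9 : ℝ) / 4)) ∧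
        (volume {y | y ∈ annulus R ∧ t < |bern V P y| * ‖V y‖}).toReal ≤
          C * t ^ (-((3 : ℝ) / 2)) := by
  intro ν _hν v p hflow hweak c _hpc hbern n _hn V P hVm hPm hloc hconvV hconvP
  set q : E3 → ℝ := fun x => p x - c with hq_def
  set Wv : ℝ≥0∞ := eWeakLpPow v ((9 : ℝ≥0∞) / 2) volume with hWv
  set WQ : ℝ≥0∞ := eWeakLpPow (bern v q) ((9 : ℝ≥0∞) / 4) volume with hWQ
  have hWv_lt : Wv < ∞ := hweak.2
  have hWQ_lt : WQ < ∞ := hbern.2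
  have hW_ne : Wv + WQ ≠ ∞ := ENNReal.add_ne_top.2 ⟨hWv_lt.ne, hWQ_lt.ne⟩
  have hvc : Continuous v := hflow.smooth_v.continuous
  have hqc : Continuous q := hflow.smooth_p.continuous.sub continuous_const
  set Vj : ℕ → E3 → E3 := fun j => blowDown ((2 : ℝ) ^ n j) v with hVj_def
  set Pj : ℕ → E3 → ℝ := fun j => blowDownP ((2 : ℝ) ^ n j) q with hPj_def
  have hRj : ∀ j, (0 : ℝ) < (2 : ℝ) ^ n j := fun j => pow_pos two_pos _
  have hVjc : ∀ j, Continuous (Vj j) := fun j => continuous_blowDown hvc _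
  have hPjc : ∀ j, Continuous (Pj j) := fun j => continuous_blowDownP hqc _
  have hVjm : ∀ j, AEStronglyMeasurable (Vj j) volume := fun j => (hVjc j).aestronglyMeasurable
  have hPjm : ∀ j, AEStronglyMeasurable (Pj j) volume := fun j => (hPjc j).aestronglyMeasurable
  have hQm : AEStronglyMeasurable (bern V P) volume := by
    have : AEMeasurable (fun y => P y + ‖V y‖ ^ 2 / 2) volume :=
      hPm.aemeasurable.add ((hVm.norm.aemeasurable.pow_const 2).div_const 2)
    exact this.aestronglyMeasurable
  have hQjm : ∀ j, AEStronglyMeasurable (bern (Vj j) (Pj j)) volume := fun j => by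
    have : AEMeasurable (fun y => Pj j y + ‖Vj j y‖ ^ 2 / 2) volume :=
      (hPjm j).aemeasurable.add (((hVjm j).norm.aemeasurable.pow_const 2).div_const 2)
    exact this.aestronglyMeasurable
  refine ⟨(Wv + WQ).toReal, ENNReal.toReal_nonneg, fun R hR t ht => ?_⟩
  -- the closed shell `K ⊇ A_R` and the restricted measure
  set K : Set E3 := {y : E3 | R ≤ ‖y‖ ∧ ‖y‖ ≤ 2 * R} with hK_def
  have hK : IsCompact K := isCompact_closedShell R
  have hKp : K ⊆ punctured := closedShell_subset_punctured hR
  have hKm : MeasurableSet K := hK.isClosed.measurableSet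
  have hKfin : volume K ≠ ∞ := hK.measure_lt_top.ne
  set μ : Measure E3 := volume.restrict K with hμ
  -- convergences on `K`
  have hV4 : ∫⁻ y in K, ‖V y‖ₑ ^ (4 : ℝ) ≠ ∞ :=
    (lintegral_enorm_rpow_lt_top_of_integrableOn (by norm_num) (hloc K hK hKp).1).ne
  have hP2 : ∫⁻ y in K, ‖P y‖ₑ ^ ((4 : ℝ) / 2) ≠ ∞ := by
    have hPK : IntegrableOn (fun y => ‖P y‖ ^ ((4 : ℝ) / 2)) K volume := by
      simpa only [Real.norm_eq_abs] using (hloc K hK hKp).2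
    exact (lintegral_enorm_rpow_lt_top_of_integrableOn (by norm_num) hPK).ne
  have hdlim : Tendsto (fun j => ∫⁻ y in K, ‖Vj j y - V y‖ₑ ^ (4 : ℝ)) atTop (𝓝 0) :=
    tendsto_lintegral_V_sub_of_integral hvc hK hVm (hloc K hK hKp).1 (hconvV K hK hKp)
  have helim : Tendsto (fun j => ∫⁻ y in K, ‖Pj j y - P y‖ₑ ^ ((4 : ℝ) / 2)) atTop (𝓝 0) :=
    tendsto_lintegral_P_sub_of_integral hqc hK hPm (hloc K hK hKp).2 (hconvP K hK hKp)
  -- (i) `V_j → V` in `L⁴(μ)`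
  have hlimV : Tendsto (fun j => eLpNorm (Vj j - V) (ENNReal.ofReal 4) μ) atTop (𝓝 0) :=
    tendsto_eLpNorm_of_tendsto_lintegral_rpow (by norm_num) hdlim
  -- (ii) `Q_j → Q` in `L¹(μ)`
  have hlimQ : Tendsto (fun j => eLpNorm (bern (Vj j) (Pj j) - bern V P) (ENNReal.ofReal 1) μ)
      atTop (𝓝 0) := by
    refine tendsto_eLpNorm_of_tendsto_lintegral_rpow one_pos ?_
    simp only [ENNReal.rpow_one]
    exact tendsto_lintegral_bern_sub hKfin hVjm hPjm hVm hPm hV4 hdlim helim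
  -- (iii) `Q_jV_j → QV` in `L¹(μ)`
  have hlimQV : Tendsto (fun j => eLpNorm ((fun y => bern (Vj j) (Pj j) y • Vj j y) -
      (fun y => bern V P y • V y)) (ENNReal.ofReal 1) μ) atTop (𝓝 0) := by
    refine tendsto_eLpNorm_of_tendsto_lintegral_rpow one_pos ?_
    simp only [ENNReal.rpow_one]
    exact tendsto_lintegral_bernV_sub_raw hKfin hVjm hPjm hVm hPm hV4 hP2 hdlim helim
  have h4 : ENNReal.ofReal 4 ≠ 0 := by norm_num
  have h1 : ENNReal.ofReal 1 ≠ 0 := by norm_num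
  -- from the annulus to the restricted measure
  have hann : ∀ S : Set E3, volume {y | y ∈ annulus R ∧ y ∈ S} ≤ μ S := fun S => by
    rw [hμ, Measure.restrict_apply' hKm]
    exact measure_mono fun y hy => ⟨hy.2, annulus_subset_closedShell R hy.1⟩
  have htoReal : ∀ {X : ℝ≥0∞} {W : ℝ≥0∞} {e : ℝ}, W ≤ Wv + WQ →
      X ≤ W * ENNReal.ofReal (t ^ e) → X.toReal ≤ (Wv + WQ).toReal * t ^ e := by
    intro X W e hW hX
    have hX' : X ≤ (Wv + WQ) * ENNReal.ofReal (t ^ e) := hX.trans (by gcongr)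
    have := ENNReal.toReal_mono (ENNReal.mul_ne_top hW_ne ENNReal.ofReal_ne_top) hX'
    rwa [ENNReal.toReal_mul, ENNReal.toReal_ofReal (Real.rpow_nonneg ht.le _)] at this
  refine ⟨?_, ?_, ?_⟩
  · -- |V| on A_R
    refine htoReal (le_self_add) ((hann {y | t < ‖V y‖}).trans ?_)
    refine meas_lt_norm_le_of_tendsto_eLpNorm (fun j => (hVjm j).restrict) hVm.restrict h4 hlimV
      ht fun j => (Measure.restrict_apply_le K _).trans ?_
    exact meas_lt_norm_blowDown_le v (hRj j) ht
  · -- |Q| on A_R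
    have hset : {y | y ∈ annulus R ∧ t < |bern V P y|} = {y | y ∈ annulus R ∧ t < ‖bern V P y‖} := by
      simp only [Real.norm_eq_abs]
    rw [hset]
    refine htoReal (le_add_self) ((hann {y | t < ‖bern V P y‖}).trans ?_)
    refine meas_lt_norm_le_of_tendsto_eLpNorm (fun j => (hQjm j).restrict) hQm.restrict h1 hlimQ
      ht fun j => (Measure.restrict_apply_le K _).trans ?_
    simp only [Real.norm_eq_abs]
    exact meas_lt_abs_bern_blowDown_le v q (hRj j) ht
  · -- |Q||V| on A_R
    have hset : {y | y ∈ annulus R ∧ t < |bern V P y| * ‖V y‖} =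
        {y | y ∈ annulus R ∧ t < ‖bern V P y • V y‖} := by
      simp only [norm_smul, Real.norm_eq_abs]
    rw [hset]
    refine htoReal le_rfl ((hann {y | t < ‖bern V P y • V y‖}).trans ?_)
    have hQVm : AEStronglyMeasurable (fun y => bern V P y • V y) μ := (hQm.smul hVm).restrict
    have hQVjm : ∀ j, AEStronglyMeasurable (fun y => bern (Vj j) (Pj j) y • Vj j y) μ := fun j =>
      ((hQjm j).smul (hVjm j)).restrict
    refine meas_lt_norm_le_of_tendsto_eLpNorm hQVjm hQVm h1 hlimQV ht fun j =>
      (Measure.restrict_apply_le K _).trans ?_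
    simp only [norm_smul, Real.norm_eq_abs]
    exact meas_lt_abs_bern_mul_norm_blowDown_le v q (hRj j) ht

end Summit.NavierStokesRegularity.NavierStokesRegularity.Theorems.Wu2026Salvage

end

-- WHAT THIS IS NOT: not a claim about NS regularity or blow-up; not a claim about any author beyond the typed locator.

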